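import Summits.ValiantsHypothesis.ValiantsHypothesis.Theorems.FifoMatchingNNDivisionHardSwitchedFaceTower
import Summits.ValiantsHypothesis.ValiantsHypothesis.Theorems.FifoMatchingNNDivisionHardLowDimFace
import HarnessLib

/-!
# The SWITCHED-FACE RUNGS, part 3: the PSD-ZONOTOPE rung — a generic direction of the normal cone of `F_0` sees every ±Gram generator (§7)

Theorems-side TRANSPLANT (port hand val-port-1 g3; crit-9 g1 CONFIRM 21:07:55Z «P-P2a′», director R298 (2), desk RULING #347 (A);
`--supports stmt-ValiantsHypothesis-21181 --as helper`) of val-idea-38 g1's crux workfile `Cruxes/NNDivisionHard/SwitchFaceTowerRung.lean`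
REV 4 FINAL @27833a3f9586 (sha16 9555358f6f12b67d, 909 l.; farm rc 0 / 0 sorry / 0 warnings; crit-9 g1 re-probes of rev 3 VERIFIED, axioms std)
— texts VERBATIM, namespace moved `…Cruxes.NNDivisionHard.SwitchFace` ↦ `…Theorems.FifoMatching.SwitchFace`, the 909-line file split by the
400-line cap into four modules `…SwitchedFaceTower(Face | · | Zonotope | Tolerant).lean` (§1–§3 / §4–§6 / §7 / §8–§9).  This module: §7a positivity-preserving genericity, §7b the generic functional `C_ε`, §7c zonotope vertex lemma, §7d `psdZonotopeRung_holds`.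
Credit: statements + proofs val-idea-38 g1 (W5-P2, card `Cruxes/NNDivisionHard/Ideas/switched-face-psd-free.md`); critic of record val-idea-crit-9 g1.
HONEST FRAMING: kernel food for an OPEN crux — located-point / switched-face certificates decide CLASSES of passengers (every 0-1 rank-one tower,
`COR − COR`, ±PSD zonotopes, self-similar read fibres) at the Kaibel–Weltge rate; stmt-21181 `NNDivisionHard` OPEN; COR-VIRTUAL OPEN;
`VP ≠ VNP` NOT proved; nothing here is a summit statement.
-/

set_option autoImplicit false

-- the mandated summit-side namespace repeats a component by design (single-problem summit)
set_option linter.dupNamespace false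

noncomputable section

open Matrix Finset
open scoped Pointwise

namespace Summit.ValiantsHypothesis.ValiantsHypothesis.Theorems.FifoMatching.SwitchFace

open Literature.Barriers.PneNP (HasEFOfSize)
open Literature.Combinatorics.Optimization (corPolytopeGraph corVec)
open Summit.ValiantsHypothesis.ValiantsHypothesis.Theorems.FifoMatching.XcDivision
  (dot_le_of_mem_convexHull convexHull_range_inter_eq corVec_top_apply corPolytopeGraph_top_add_hull_three_pow_le)

open Summit.ValiantsHypothesis.ValiantsHypothesis.Theorems.FifoMatching.LowDim (exists_large_avoid)

variable {n : ℕ}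

/-! ## §7 The PSD-ZONOTOPE rung: a GENERIC direction of the normal cone of `F_0` sees every `±`Gram generator (S4 + S5) -/

/-! ### §7a positivity-preserving genericity (40's `exists_generic_comb`, keeping the signs its own proof produces) -/

-- `exists_large_avoid` is the landed `LowDim.exists_large_avoid` (✓ p664719 `…LowDimFace`, same statement; dedup) — reused by name.


/-- ★ GENERICITY WITH SIGNS: finitely many test points, each seen by some test functional, are simultaneously separated by a
combination with ALL COEFFICIENTS POSITIVE (so the combination stays inside an open orthant = the relative interior of a normal cone). -/
theorem exists_generic_comb_pos {K E : Type} [Fintype K] [DecidableEq K] (T : Finset E) (ψ : K → E → ℝ) :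
    ∃ ε : K → ℝ, (∀ t, 0 < ε t) ∧ ∀ Δ ∈ T, (∃ t, ψ t Δ ≠ 0) → ∑ t, ε t * ψ t Δ ≠ 0 := by
  classical
  suffices h : ∀ s : Finset K, ∃ ε : K → ℝ, (∀ t ∉ s, ε t = 0) ∧ (∀ t ∈ s, 0 < ε t) ∧
      ∀ Δ ∈ T, (∃ t ∈ s, ψ t Δ ≠ 0) → ∑ t, ε t * ψ t Δ ≠ 0 by
    obtain ⟨ε, -, hpos, hε⟩ := h Finset.univ
    exact ⟨ε, fun t => hpos t (Finset.mem_univ t), fun Δ hΔ ⟨t, ht⟩ => hε Δ hΔ ⟨t, Finset.mem_univ t, ht⟩⟩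
  intro s
  induction s using Finset.induction_on with
  | empty =>
    exact ⟨0, fun _ _ => rfl, fun t ht => absurd ht (by simp), fun Δ _ ⟨t, ht, _⟩ => absurd ht (by simp)⟩
  | insert a s ha ih =>
    obtain ⟨ε', hsupp, hpos, hsep⟩ := ih
    let pr : E → ℝ × ℝ := fun Δ => (ψ a Δ, ∑ t, ε' t * ψ t Δ)
    obtain ⟨τ, hτpos, hτ⟩ := exists_large_avoid ((T.image pr).filter fun p => p.1 ≠ 0 ∨ p.2 ≠ 0)
      (fun p hp => (Finset.mem_filter.1 hp).2) 0
    refine ⟨fun t => ε' t + (if t = a then τ else 0), ?_, ?_, ?_⟩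
    · intro t ht
      rw [Finset.mem_insert, not_or] at ht
      show ε' t + (if t = a then τ else 0) = 0
      rw [hsupp t ht.2, if_neg ht.1, add_zero]
    · intro t ht
      show 0 < ε' t + (if t = a then τ else 0)
      rw [Finset.mem_insert] at ht
      by_cases hta : t = a
      · rw [if_pos hta, hta, hsupp a ha, zero_add]
        exact hτpos
      · rw [if_neg hta, add_zero]
        exact hpos t (ht.resolve_left hta)
    · intro Δ hΔ hex
      have hsum : ∑ t, (ε' t + (if t = a then τ else 0)) * ψ t Δ =
          (∑ t, ε' t * ψ t Δ) + τ * ψ a Δ := by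
        simp only [add_mul, Finset.sum_add_distrib, ite_mul, zero_mul, Finset.sum_ite_eq',
          Finset.mem_univ, if_true]
      rw [hsum]
      by_cases hpair : ψ a Δ ≠ 0 ∨ ∑ t, ε' t * ψ t Δ ≠ 0
      · have hmem : pr Δ ∈ (T.image pr).filter fun p => p.1 ≠ 0 ∨ p.2 ≠ 0 :=
          Finset.mem_filter.2 ⟨Finset.mem_image_of_mem pr hΔ, hpair⟩
        have hne := hτ (pr Δ) hmem
        intro h0
        apply hne
        show ψ a Δ * τ + ∑ t, ε' t * ψ t Δ = 0
        linarith
      · rw [not_or, not_not, not_not] at hpair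
        obtain ⟨t, ht, hne⟩ := hex
        rw [Finset.mem_insert] at ht
        rcases ht with rfl | ht
        · exact absurd hpair.1 hne
        · exact absurd hpair.2 (hsep Δ hΔ ⟨t, ht, hne⟩)

/-! ### §7b the generic functional `C_ε = Σ_t ε_t ψ_t` of the normal cone of `F_0` -/

/-- test functionals of the switched face `F_0`: `ψ_0(x) = x_00`, `ψ_t(x) = x_0t − x_tt` (`t ≠ 0`).  `x` is `F_0`-ALIGNED iff all vanish. -/
def psi (n : ℕ) (t : Fin (n + 1)) (x : Fin (n + 1) × Fin (n + 1) → ℝ) : ℝ :=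
  if t = 0 then x (0, 0) else x (0, t) - x (t, t)

/-- the test functionals are odd under negation of the argument. -/
theorem psi_neg (t : Fin (n + 1)) (x : Fin (n + 1) × Fin (n + 1) → ℝ) : psi n t (-x) = -psi n t x := by
  unfold psi
  split_ifs
  · rfl
  · simp only [Pi.neg_apply]
    ring

/-- a generic functional `C_ε = Σ_t ε_t ψ_t` of the normal cone of `F_0` exists, through its dot products. -/
theorem exists_genFun (ε : Fin (n + 1) → ℝ) :
    ∃ C : Fin (n + 1) × Fin (n + 1) → ℝ, ∀ x, C ⬝ᵥ x = ∑ t, ε t * psi n t x := by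
  classical
  refine ⟨∑ t : Fin (n + 1), ε t • (if t = 0 then (Pi.single (0, 0) 1 : Fin (n + 1) × Fin (n + 1) → ℝ)
    else Pi.single (0, t) 1 - Pi.single (t, t) 1), fun x => ?_⟩
  rw [sum_dotProduct]
  refine Finset.sum_congr rfl fun t _ => ?_
  rw [smul_dotProduct, smul_eq_mul, psi]
  congr 1
  split_ifs
  · rw [single_dotProduct, one_mul]
  · rw [sub_dotProduct, single_dotProduct, single_dotProduct, one_mul, one_mul]

/-- S4 — **PSD-FREENESS** of `lin F_0`: a Gram vector killed by every `ψ_t` is zero (`g_00 = |v_0|² = 0 ⇒ v_0 = 0 ⇒ g_0t = 0 ⇒ g_tt = |v_t|² = 0`). -/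
theorem gram_eq_zero_of_psi {g : Fin (n + 1) × Fin (n + 1) → ℝ}
    (hg : ∃ (k : ℕ) (v : Fin (n + 1) → Fin k → ℝ), ∀ p q, g (p, q) = ∑ i, v p i * v q i)
    (h : ∀ t, psi n t g = 0) : g = 0 := by
  obtain ⟨k, v, hv⟩ := hg
  have h00 : g (0, 0) = 0 := by have := h 0; unfold psi at this; rwa [if_pos rfl] at this
  have hv0 : ∀ i, v 0 i = 0 := by
    have hs : ∑ i, v 0 i * v 0 i = 0 := by rw [← hv 0 0]; exact h00
    intro i
    exact mul_self_eq_zero.1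
      ((Finset.sum_eq_zero_iff_of_nonneg fun i _ => mul_self_nonneg (v 0 i)).1 hs i (Finset.mem_univ i))
  have hvt : ∀ t i, v t i = 0 := by
    intro t
    by_cases ht : t = 0
    · rw [ht]; exact hv0
    · have h1 := h t
      unfold psi at h1
      rw [if_neg ht, hv, hv] at h1
      have h0t : ∑ i, v 0 i * v t i = 0 := Finset.sum_eq_zero fun i _ => by rw [hv0 i, zero_mul]
      rw [h0t, zero_sub, neg_eq_zero] at h1
      intro i
      exact mul_self_eq_zero.1
        ((Finset.sum_eq_zero_iff_of_nonneg fun i _ => mul_self_nonneg (v t i)).1 h1 i (Finset.mem_univ i))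
  funext pq
  obtain ⟨p, q⟩ := pq
  show g (p, q) = 0
  rw [hv]
  exact Finset.sum_eq_zero fun i _ => by rw [hvt p i, zero_mul]

section GenFun

variable {ε : Fin (n + 1) → ℝ} {C : Fin (n + 1) × Fin (n + 1) → ℝ} (hCε : ∀ x, C ⬝ᵥ x = ∑ t, ε t * psi n t x)
include hCε

/-- value of `C_ε` on the vertices of `COR(K_{n+1})`: `ε_0` on `F_0`, `−Σ_{t ≠ 0, b t} ε_t` off it. -/
theorem gen_dot_corVec (b : Fin (n + 1) → Bool) :
    C ⬝ᵥ corVec (⊤ : SimpleGraph (Fin (n + 1))) b =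
      if b 0 = true then ε 0 else -(∑ t, if t ≠ 0 then (if b t = true then ε t else 0) else 0) := by
  rw [hCε]
  cases hb0 : b 0 with
  | false =>
    rw [if_neg Bool.false_ne_true, ← Finset.sum_neg_distrib]
    refine Finset.sum_congr rfl fun t _ => ?_
    unfold psi
    by_cases ht : t = 0
    · rw [if_pos ht, if_neg (not_not.mpr ht), corVec_top_apply, neg_zero]
      simp [hb0]
    · rw [if_neg ht, if_pos ht, corVec_top_apply, corVec_top_apply]
      cases b t <;> simp [hb0]
  | true =>
    rw [if_pos rfl]
    have h0 : ε 0 * psi n 0 (corVec (⊤ : SimpleGraph (Fin (n + 1))) b) = ε 0 := by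
      unfold psi; rw [if_pos rfl, corVec_top_apply]; simp [hb0]
    rw [← Finset.add_sum_erase _ _ (Finset.mem_univ (0 : Fin (n + 1))), h0]
    suffices hs : ∑ t ∈ Finset.univ.erase (0 : Fin (n + 1)), ε t * psi n t (corVec (⊤ : SimpleGraph (Fin (n + 1))) b) = 0 by
      rw [hs, add_zero]
    refine Finset.sum_eq_zero fun t ht => ?_
    have ht0 : t ≠ 0 := Finset.ne_of_mem_erase ht
    unfold psi
    rw [if_neg ht0, corVec_top_apply, corVec_top_apply]
    cases b t <;> simp [hb0]

/-- validity (`ε > 0`). -/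
theorem gen_dot_corVec_le (hε : ∀ t, 0 < ε t) (b : Fin (n + 1) → Bool) :
    C ⬝ᵥ corVec (⊤ : SimpleGraph (Fin (n + 1))) b ≤ ε 0 := by
  rw [gen_dot_corVec hCε]
  split_ifs
  · exact le_rfl
  · have h1 : 0 ≤ ∑ t : Fin (n + 1), (if t ≠ 0 then (if b t = true then ε t else 0) else 0) :=
      Finset.sum_nonneg fun t _ => by split_ifs <;> first | exact (hε t).le | exact le_rfl
    linarith [hε 0]

/-- tight EXACTLY on `F_0`. -/
theorem gen_dot_corVec_eq_iff (hε : ∀ t, 0 < ε t) (b : Fin (n + 1) → Bool) :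
    C ⬝ᵥ corVec (⊤ : SimpleGraph (Fin (n + 1))) b = ε 0 ↔ b 0 = true := by
  rw [gen_dot_corVec hCε]
  constructor
  · intro h
    by_contra hb
    rw [if_neg hb] at h
    have h1 : 0 ≤ ∑ t : Fin (n + 1), (if t ≠ 0 then (if b t = true then ε t else 0) else 0) :=
      Finset.sum_nonneg fun t _ => by split_ifs <;> first | exact (hε t).le | exact le_rfl
    linarith [hε 0]
  · intro hb
    rw [if_pos hb]

end GenFun

/-! ### §7c the `C`-face of a zonotope all of whose nonzero generators are seen by `C` is ONE vertex -/

/-- sign vertices of the zonotope `Σ_g [−1,1]·gen g`. -/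
def zvtx {G : ℕ} {m : ℕ} (gen : Fin G → (Fin m × Fin m → ℝ)) (e : Fin G → Bool) : Fin m × Fin m → ℝ :=
  ∑ g, (if e g then (1 : ℝ) else -1) • gen g

/-- the maximising sign pattern. -/
def zsgn {G : ℕ} {m : ℕ} (C : Fin m × Fin m → ℝ) (gen : Fin G → (Fin m × Fin m → ℝ)) : Fin G → Bool :=
  fun g => decide (0 ≤ C ⬝ᵥ gen g)

/-- the value of `C` at a zonotope vertex. -/
theorem dot_zvtx {G m : ℕ} (C : Fin m × Fin m → ℝ) (gen : Fin G → (Fin m × Fin m → ℝ)) (e : Fin G → Bool) :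
    C ⬝ᵥ zvtx gen e = ∑ g, (if e g then (1 : ℝ) else -1) * (C ⬝ᵥ gen g) := by
  unfold zvtx
  rw [dotProduct_sum]
  refine Finset.sum_congr rfl fun g _ => ?_
  rw [dotProduct_smul, smul_eq_mul]

/-- uniqueness of the maximiser AS A POINT (free signs occur only at generators `C` does not see, i.e. at zero generators). -/
theorem zvtx_unique {G m : ℕ} (C : Fin m × Fin m → ℝ) (gen : Fin G → (Fin m × Fin m → ℝ))
    (hnz : ∀ g, gen g ≠ 0 → C ⬝ᵥ gen g ≠ 0) (e : Fin G → Bool) :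
    C ⬝ᵥ zvtx gen e < C ⬝ᵥ zvtx gen (zsgn C gen) ∨ zvtx gen e = zvtx gen (zsgn C gen) := by
  have hle_t : ∀ g, (if e g = true then (1 : ℝ) else -1) * (C ⬝ᵥ gen g) ≤ |C ⬝ᵥ gen g| :=
    fun g => sign_mul_le _ _
  have hmax : C ⬝ᵥ zvtx gen (zsgn C gen) = ∑ g, |C ⬝ᵥ gen g| := by
    rw [dot_zvtx]
    exact Finset.sum_congr rfl fun g _ => dsign_mul _
  have hle : C ⬝ᵥ zvtx gen e ≤ ∑ g, |C ⬝ᵥ gen g| := by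
    rw [dot_zvtx]; exact Finset.sum_le_sum fun g _ => hle_t g
  rcases lt_or_eq_of_le hle with hlt | heq
  · left
    rwa [hmax]
  · right
    have hterm := (Finset.sum_eq_sum_iff_of_le fun g (_ : g ∈ Finset.univ) => hle_t g).1
      (by rw [dot_zvtx] at heq; exact heq)
    unfold zvtx
    refine Finset.sum_congr rfl fun g _ => ?_
    have hg := hterm g (Finset.mem_univ g)
    by_cases hw : C ⬝ᵥ gen g = 0
    · have h0 : gen g = 0 := by
        by_contra hne
        exact hnz g hne hw
      rw [h0, smul_zero, smul_zero]
    · have hs := dsign_mul (C ⬝ᵥ gen g)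
      have key : (if e g = true then (1 : ℝ) else -1) = (if zsgn C gen g = true then 1 else -1) := by
        unfold zsgn
        exact mul_right_cancel₀ hw (hg.trans hs.symm)
      rw [key]

/-! ### §7d assembly (same text as `SwitchFace.zonotopeOf` / `IsGram` / `PSDZonotopeRung`) -/

/-- a ZONOTOPE with generator list `gen`: `Σ_i [−1,1]·gen i` (as the hull of its sign vertices). -/
def zonotopeOf {ι : Type} (G : ℕ) (gen : Fin G → (ι → ℝ)) : Set (ι → ℝ) :=
  convexHull ℝ (Set.range fun ε : Fin G → Bool => ∑ g, (if ε g then (1 : ℝ) else -1) • gen g)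

/-- Gram / positive-semidefinite vectors `g_pq = ⟨v_p, v_q⟩`. -/
def IsGram {n : ℕ} (g : Fin n × Fin n → ℝ) : Prop :=
  ∃ (k : ℕ) (v : Fin n → Fin k → ℝ), ∀ p q, g (p, q) = ∑ i, v p i * v q i

/-- ★★ **PSD-ZONOTOPE RUNG** (verbatim `SwitchFace.PSDZonotopeRung`): every zonotope whose generators are each positive OR negative
semidefinite satisfies `xc(COR(K_{n+1}) + Z) ≥ xc(COR(K_n))`. -/
def PSDZonotopeRung : Prop :=
  ∀ (n G : ℕ) (gen : Fin G → (Fin (n + 1) × Fin (n + 1) → ℝ)) (r : ℕ),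
    (∀ g, IsGram (gen g) ∨ IsGram (-gen g)) →
      HasEFOfSize (corPolytopeGraph (⊤ : SimpleGraph (Fin (n + 1))) + zonotopeOf G gen) r →
        HasEFOfSize (corPolytopeGraph (⊤ : SimpleGraph (Fin n))) r

/-- ★★ **THE PSD-ZONOTOPE RUNG HOLDS** (real rank-one towers `Σ [−1,1] v_i v_iᵀ`, Gram zonotopes, any zone count — unbudgeted). -/
theorem psdZonotopeRung_holds : PSDZonotopeRung := by
  classical
  intro n G gen r hgram h
  obtain ⟨ε, hε, hsep⟩ := exists_generic_comb_pos (K := Fin (n + 1)) (Finset.univ.image gen) (psi n)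
  obtain ⟨C, hCε⟩ := exists_genFun (n := n) ε
  have hnz : ∀ g, gen g ≠ 0 → C ⬝ᵥ gen g ≠ 0 := by
    intro g hg
    rw [hCε]
    refine hsep (gen g) (Finset.mem_image_of_mem gen (Finset.mem_univ g)) ?_
    by_contra hall
    have hall' : ∀ t, psi n t (gen g) = 0 := fun t => not_not.mp (not_exists.mp hall t)
    rcases hgram g with hG | hG
    · exact hg (gram_eq_zero_of_psi hG hall')
    · have hneg : -gen g = 0 :=
        gram_eq_zero_of_psi hG fun t => by rw [psi_neg, hall' t, neg_zero]
      exact hg (neg_eq_zero.mp hneg)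
  exact located_point_rung 0 C (ε 0) (gen_dot_corVec_le hCε hε) (gen_dot_corVec_eq_iff hCε hε) (zvtx gen) (zsgn C gen)
    (zvtx_unique C gen hnz) r h

/-- COROLLARY: `xc(COR(K_{n+1}) + Z) = r` for a `±`PSD-generated zonotope `Z` ⇒ `3^n ≤ (r+1)·2^n`. -/
theorem psdZonotope_three_pow_le (n G : ℕ) (gen : Fin G → (Fin (n + 1) × Fin (n + 1) → ℝ)) (r : ℕ)
    (hgram : ∀ g, IsGram (gen g) ∨ IsGram (-gen g))
    (h : HasEFOfSize (corPolytopeGraph (⊤ : SimpleGraph (Fin (n + 1))) + zonotopeOf G gen) r) :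
    3 ^ n ≤ (r + 1) * 2 ^ n :=
  Literature.Barriers.PneNP.corPolytopeGraph_top_three_pow_le (psdZonotopeRung_holds n G gen r hgram h)

end Summit.ValiantsHypothesis.ValiantsHypothesis.Theorems.FifoMatching.SwitchFace

end
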